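import Literature.NumberTheory.Transcendental.ExpOneTranscendenceMeasureZeroEstimate
import HarnessLib

/-!
# Transcendence measure for `e` (Nesterenko–Waldschmidt 1996) — VI: the interpolation matrix

Topic `Literature/NumberTheory/Transcendental`; sibling proof file of
`ExpOneTranscendenceMeasure.lean` (the named fact
`Literature.NumberTheory.Transcendental.NesterenkoWaldschmidt1996_thm_4_2`). Everything here is
PROVED; the only definition is the integer `NW1996.pcoef σ τ s t = ∑ₖ C(σ,k) τ(τ-1)⋯(τ-k+1) s^{τ-k} t^{σ-k}`
(the common coefficient of the numbers `γ` of (6.2) and `a` of (6.3) for `θ = β = 1`, `H = 1`).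

This part is step a) of [NesterenkoWaldschmidt1996, §6] for `θ = β = 1` with the functions
`f_{τ,t}(z) = z^τ e^{tz}` (`0 ≤ τ ≤ T`, `|t| ≤ T₁`): the derivative of order `σ` of `f_{τ,t}` at the
integer `s` is `γ = pcoef(σ,τ,s,t) · e^{ts}` (`NW1996.iteratedDeriv_monomialExp`), the corresponding
algebraic number is `a = pcoef(σ,τ,s,t) · ξ^{ts}` (`e` replaced by the algebraic approximation `ξ`).
Lemma 6 (the matrix `(a)` indexed by `(σ,s)` and `(τ,t)` has full column rank, `NW1996.algMatrix_mulVec_eq_zero`)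
is deduced from the multiplicity estimate (part III) through the identity
`((∂ + t)^σ X^τ)(s) = pcoef(σ,τ,s,t)` (`NW1996.eval_twist_pow_X_pow`), under the counting condition
`(2T₁+1)T < (S+1-2T₁)(2S₁+1)`; `NW1996.exists_submatrix_det_ne_zero` then extracts a non-singular
`L × L` minor (full column rank ⇒ some `L` rows are independent). Finally the size estimates used in
steps b), c): `|pcoef| ≤ S₁^T (T+T₁)^S` (`NW1996.abs_pcoef_le`), the bound for `|f^{(σ)}_{τ,t}(z)|`
on `|z| ≤ E S₁` (`NW1996.norm_iteratedDeriv_monomialExp_le`) and the perturbation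
`|ξ^j - e^j| ≤ N 4^N |ξ - e|` (`NW1996.norm_zpow_sub_zpow_le`).

## References

* [NesterenkoWaldschmidt1996] Yu. V. Nesterenko, M. Waldschmidt, *On the approximation of the values
  of exponential function and logarithm by algebraic numbers*, Mat. Zapiski 2 (1996), 23–42;
  arXiv:math/0002047, §6 a), (6.2), (6.3), Lemma 6.
-/

noncomputable section

open Polynomial Finset Complex Matrix

namespace Literature.NumberTheory.Transcendental

namespace NW1996

/-! ### The common integer coefficient -/

/-- `pcoef σ τ s t = ∑_{k=0}^{σ} C(σ,k) · τ(τ-1)⋯(τ-k+1) · s^{τ-k} · t^{σ-k}`: the `σ`-th derivative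
of `z^τ e^{tz}` at `z = s` is `pcoef σ τ s t · e^{ts}` ([NesterenkoWaldschmidt1996, (6.2)] with
`Δ(z,τ,1) = z^τ`, `θ = 1`), and `((∂ + t)^σ X^τ)(s) = pcoef σ τ s t`.
[cite: NesterenkoWaldschmidt1996, §6 (6.2)] -/
def pcoef (σ τ : ℕ) (s t : ℤ) : ℤ :=
  ∑ k ∈ range (σ + 1), (σ.choose k : ℤ) * (τ.descFactorial k : ℤ) * s ^ (τ - k) * t ^ (σ - k)

/-- `((∂ + t)^σ X^τ)(s) = pcoef σ τ s t` (the action of `δ^σ` on `X^τ Y^t` at `(s, ·)`, `β = 1`).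
[cite: NesterenkoWaldschmidt1996, §6 Lemma 6] -/
theorem eval_twist_pow_X_pow (σ τ : ℕ) (s t : ℤ) :
    ((twist (t : ℂ) ^ σ) (X ^ τ : ℂ[X])).eval (s : ℂ) = (pcoef σ τ s t : ℂ) := by
  have h := twist_pow_mul (t : ℂ) (X ^ τ : ℂ[X]) 1 σ
  rw [mul_one] at h
  rw [h, eval_finsetSum, Finset.Nat.sum_antidiagonal_eq_sum_range_succ_mk, pcoef]
  push_cast
  refine Finset.sum_congr rfl fun k hk => ?_
  rw [iterate_derivative_X_pow_eq_smul, twist_pow_one, eval_smul, eval_mul, eval_smul, eval_pow,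
    eval_X, eval_C, nsmul_eq_mul, smul_eq_mul]
  ring

/-- `|pcoef σ τ s t| ≤ S₁^T (T + T₁)^S` for `|s| ≤ S₁`, `|t| ≤ T₁`, `τ ≤ T`, `σ ≤ S`, `S₁ ≥ 1`
([NesterenkoWaldschmidt1996, §6 b)–c)], the analogue of Lemma 4 (4.3) for `H = 1`).
[cite: NesterenkoWaldschmidt1996, §6] -/
theorem abs_pcoef_le {σ τ S T S₁ T₁ : ℕ} {s t : ℤ} (hσ : σ ≤ S) (hτ : τ ≤ T) (hS₁ : 1 ≤ S₁)
    (hT₁ : 1 ≤ T₁) (hs : |s| ≤ S₁) (ht : |t| ≤ T₁) :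
    |(pcoef σ τ s t : ℝ)| ≤ (S₁ : ℝ) ^ T * ((T : ℝ) + T₁) ^ S := by
  have hS₁r : (1 : ℝ) ≤ S₁ := by exact_mod_cast hS₁
  have hsr : |(s : ℝ)| ≤ S₁ := by rw [← Int.cast_abs]; exact_mod_cast hs
  have htr : |(t : ℝ)| ≤ T₁ := by rw [← Int.cast_abs]; exact_mod_cast ht
  rw [pcoef]
  push_cast
  refine (Finset.abs_sum_le_sum_abs _ _).trans ?_
  calc ∑ k ∈ range (σ + 1), |(σ.choose k : ℝ) * (τ.descFactorial k : ℝ) * (s : ℝ) ^ (τ - k) * (t : ℝ) ^ (σ - k)|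
      ≤ ∑ k ∈ range (σ + 1), (T : ℝ) ^ k * (T₁ : ℝ) ^ (σ - k) * (σ.choose k : ℝ) * (S₁ : ℝ) ^ τ := by
        refine Finset.sum_le_sum fun k _ => ?_
        rw [abs_mul, abs_mul, abs_mul, abs_pow, abs_pow, Nat.abs_cast, Nat.abs_cast]
        have h1 : (τ.descFactorial k : ℝ) ≤ (T : ℝ) ^ k := by
          calc (τ.descFactorial k : ℝ) ≤ (τ : ℝ) ^ k := by exact_mod_cast Nat.descFactorial_le_pow τ k
            _ ≤ (T : ℝ) ^ k := pow_le_pow_left₀ (Nat.cast_nonneg _) (by exact_mod_cast hτ) k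
        have h2 : |(s : ℝ)| ^ (τ - k) ≤ (S₁ : ℝ) ^ τ :=
          (pow_le_pow_left₀ (abs_nonneg _) hsr _).trans (pow_le_pow_right₀ hS₁r (Nat.sub_le _ _))
        have h3 : |(t : ℝ)| ^ (σ - k) ≤ (T₁ : ℝ) ^ (σ - k) := pow_le_pow_left₀ (abs_nonneg _) htr _
        calc (σ.choose k : ℝ) * (τ.descFactorial k : ℝ) * |(s : ℝ)| ^ (τ - k) * |(t : ℝ)| ^ (σ - k)
            ≤ (σ.choose k : ℝ) * (T : ℝ) ^ k * (S₁ : ℝ) ^ τ * (T₁ : ℝ) ^ (σ - k) := by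
              gcongr
          _ = (T : ℝ) ^ k * (T₁ : ℝ) ^ (σ - k) * (σ.choose k : ℝ) * (S₁ : ℝ) ^ τ := by ring
    _ = ((T : ℝ) + T₁) ^ σ * (S₁ : ℝ) ^ τ := by rw [← Finset.sum_mul, add_pow]
    _ ≤ ((T : ℝ) + T₁) ^ S * (S₁ : ℝ) ^ T := by
        have hTT : (1 : ℝ) ≤ (T : ℝ) + T₁ := by
          have : (1 : ℝ) ≤ T₁ := by exact_mod_cast hT₁
          linarith [(Nat.cast_nonneg T : (0 : ℝ) ≤ T)]
        gcongr
    _ = (S₁ : ℝ) ^ T * ((T : ℝ) + T₁) ^ S := mul_comm _ _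

/-! ### Lemma 6: full column rank, and a non-singular maximal minor -/

/-- If the columns of `A : Matrix m n K` are linearly independent (`A c = 0 ⇒ c = 0`), then some
`n` rows of `A` form a non-singular square matrix (row rank = column rank). [folklore] -/
theorem exists_submatrix_det_ne_zero {m n K : Type*} [Fintype m] [Fintype n] [DecidableEq n]
    [Field K] (A : Matrix m n K) (hA : ∀ c : n → K, A *ᵥ c = 0 → c = 0) :
    ∃ r : n → m, (A.submatrix r id).det ≠ 0 := by
  classical
  -- the rows span `n → K`
  have hspan : Submodule.span K (Set.range fun i : m => A i) = ⊤ := by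
    by_contra hne
    obtain ⟨f, hf0, hle⟩ := Submodule.exists_le_ker_of_lt_top _ (lt_top_iff_ne_top.mpr hne)
    set c : n → K := fun j => f (fun j' => if j = j' then 1 else 0) with hc
    have hfx : ∀ x : n → K, f x = ∑ j, x j * c j := by
      intro x; rw [LinearMap.pi_apply_eq_sum_univ f x]; simp [hc, smul_eq_mul]
    have hAc : A *ᵥ c = 0 := by
      funext i
      have hi : A i ∈ Submodule.span K (Set.range fun i : m => A i) :=
        Submodule.subset_span ⟨i, rfl⟩
      have h := hle hi
      rw [LinearMap.mem_ker, hfx] at h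
      simpa [Matrix.mulVec, dotProduct] using h
    have hc0 := hA c hAc
    apply hf0
    refine LinearMap.ext fun x => ?_
    rw [hfx]
    simp [hc0]
  obtain ⟨b, hb_sub, hb_span, hb_li⟩ := exists_linearIndependent K (Set.range fun i : m => A i)
  rw [hspan] at hb_span
  have hbfin : b.Finite := (Set.finite_range _).subset hb_sub
  haveI : Fintype b := hbfin.fintype
  have hcard : Fintype.card n = Fintype.card b := by
    have h1 := linearIndependent_iff_card_eq_finrank_span.mp hb_li
    rw [Subtype.range_coe] at h1
    rw [h1, Set.finrank, hb_span, finrank_top, Module.finrank_fintype_fun_eq_card]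
  set e := Fintype.equivOfCardEq hcard with he
  have hrow : ∀ x : b, ∃ i : m, A i = x.1 := fun x => hb_sub x.2
  choose row hrow using hrow
  refine ⟨fun j => row (e j), ?_⟩
  have hli : LinearIndependent K (fun j => (A.submatrix (fun j => row (e j)) id) j) := by
    have h : (fun j => (A.submatrix (fun j => row (e j)) id) j) = (Subtype.val : b → n → K) ∘ e := by
      funext j; ext k; simp [Matrix.submatrix, hrow]
    rw [h]
    exact hb_li.comp e e.injective
  have hU := Matrix.linearIndependent_rows_iff_isUnit.mp hli
  exact ((Matrix.isUnit_iff_isUnit_det _).mp hU).ne_zero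

/-- **Lemma 6** ([NesterenkoWaldschmidt1996, §6 a)]) for `θ = β = 1` and the functions
`z^τ e^{tz}`: if `ξ ≠ 0`, `2T₁ ≤ S + 1` and `(2T₁+1)T < (S+1-2T₁)(2S₁+1)` (which is (2.1) with
`D₀ = T`, `D₁ = 2T₁`, `M = 2S₁+1`, `S ← S+1`), then the matrix
`a(σ,s;τ,t) = pcoef(σ,τ,s,t) ξ^{ts}` (rows `0 ≤ σ ≤ S`, `|s| ≤ S₁`; columns `0 ≤ τ ≤ T`, `|t| ≤ T₁`) has
linearly independent columns: a relation `∑ c_{τ,t} a(σ,s;τ,t) = 0` means that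
`R = ∑ c_{τ,t} X^τ Y^t` has `δ^σ R (s, ξ^s) = 0`, contradicting the multiplicity estimate (part III).
[cite: NesterenkoWaldschmidt1996, §6 Lemma 6] -/
theorem algMatrix_mulVec_eq_zero {ξ : ℂ} (hξ : ξ ≠ 0) {T T₁ S S₁ : ℕ}
    (h2T₁ : 2 * T₁ ≤ S + 1) (hcount : (2 * T₁ + 1) * T < (S + 1 - 2 * T₁) * (2 * S₁ + 1))
    (c : Fin (T + 1) × Fin (2 * T₁ + 1) → ℂ)
    (hc : (Matrix.of fun (ω : Fin (S + 1) × Fin (2 * S₁ + 1)) (μ : Fin (T + 1) × Fin (2 * T₁ + 1)) =>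
        (pcoef ω.1 μ.1 ((ω.2 : ℤ) - S₁) ((μ.2 : ℤ) - T₁) : ℂ) *
          ξ ^ (((μ.2 : ℤ) - T₁) * ((ω.2 : ℤ) - S₁))) *ᵥ c = 0) :
    c = 0 := by
  classical
  by_contra hc0
  -- the data of the multiplicity estimate
  set Q : Fin (2 * T₁ + 1) → ℂ[X] := fun b => ∑ a : Fin (T + 1), C (c (a, b)) * X ^ (a : ℕ) with hQ
  set w : Fin (2 * T₁ + 1) → ℂ := fun b => (((b : ℤ) - T₁ : ℤ) : ℂ) with hw
  set pt : Fin (2 * S₁ + 1) → ℂ := fun d => (((d : ℤ) - S₁ : ℤ) : ℂ) with hpt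
  set y : Fin (2 * S₁ + 1) → Fin (2 * T₁ + 1) → ℂ :=
    fun d b => ξ ^ (((b : ℤ) - T₁) * ((d : ℤ) - S₁)) with hy
  have hw_inj : Function.Injective w := by
    intro b b' h
    simp only [hw] at h
    have h' : ((b : ℕ) : ℤ) - T₁ = ((b' : ℕ) : ℤ) - T₁ := by exact_mod_cast h
    exact Fin.ext (by exact_mod_cast sub_left_inj.mp h')
  have hpt_inj : Function.Injective pt := by
    intro d d' h
    simp only [hpt] at h
    have h' : ((d : ℕ) : ℤ) - S₁ = ((d' : ℕ) : ℤ) - S₁ := by exact_mod_cast h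
    exact Fin.ext (by exact_mod_cast sub_left_inj.mp h')
  have hQne : ∃ b, Q b ≠ 0 := by
    by_contra hall
    push Not at hall
    apply hc0
    funext ab
    obtain ⟨a, b⟩ := ab
    have h := congrArg (fun P : ℂ[X] => P.coeff (a : ℕ)) (hall b)
    simp only [hQ, finsetSum_coeff, coeff_C_mul_X_pow, coeff_zero, Fin.val_inj] at h
    rw [Finset.sum_ite_eq] at h
    simpa using h
  have hdeg : ∀ b, (Q b).natDegree ≤ T := by
    intro b
    refine natDegree_sum_le_of_forall_le _ _ fun a _ => (natDegree_C_mul_X_pow_le _ _).trans ?_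
    have := a.isLt; omega
  have hy_ne : ∀ d b, y d b ≠ 0 := fun d b => zpow_ne_zero _ hξ
  -- the vanishing: `∑_b ((∂ + w_b)^σ Q_b)(s_d) y_{d,b} = (A c)_{(σ,d)} = 0`
  have hvanish : ∀ d, ∀ σ < S + 1,
      ∑ b, ((twist (w b) ^ σ) (Q b)).eval (pt d) * y d b = 0 := by
    intro d σ hσ
    have key : ∀ b, ((twist (w b) ^ σ) (Q b)).eval (pt d) =
        ∑ a : Fin (T + 1), c (a, b) * (pcoef σ a ((d : ℤ) - S₁) ((b : ℤ) - T₁) : ℂ) := by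
      intro b
      simp only [hQ, map_sum, eval_finsetSum]
      refine Finset.sum_congr rfl fun a _ => ?_
      rw [C_mul', map_smul, eval_smul, smul_eq_mul, hw, hpt, eval_twist_pow_X_pow]
    have h := congrFun hc (⟨σ, hσ⟩, d)
    simp only [Matrix.mulVec, dotProduct, Matrix.of_apply, Pi.zero_apply, Fintype.sum_prod_type] at h
    rw [Finset.sum_comm] at h
    rw [← h]
    refine Finset.sum_congr rfl fun b _ => ?_
    rw [key, Finset.sum_mul]
    refine Finset.sum_congr rfl fun a _ => ?_
    simp only [hy]
    ring
  have hmult := multiplicity_estimate w hw_inj Q hQne hdeg pt hpt_inj y hy_ne hvanish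
  simp only [Fintype.card_fin] at hmult
  -- the count
  have hsplit : (S + 1) * (2 * S₁ + 1) = (S + 1 - 2 * T₁) * (2 * S₁ + 1) + 2 * T₁ * (2 * S₁ + 1) := by
    rw [← Nat.add_mul, Nat.sub_add_cancel h2T₁]
  have h1 : (2 * T₁ + 1 - 1) * (2 * S₁ + 1) = 2 * T₁ * (2 * S₁ + 1) := by
    rw [Nat.add_sub_cancel]
  rw [h1] at hmult
  have := Nat.add_lt_add_right hcount (2 * T₁ * (2 * S₁ + 1))
  omega

/-! ### Determinants of matrices of monomials -/

/-- The determinant of a matrix of integer monomials `c_{ij} X^{e_{ij}}` is the signed sum over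
permutations of the monomials `(∏ c) X^{∑ e}`. [folklore] -/
theorem det_monomialMatrix {κ : Type*} [Fintype κ] [DecidableEq κ] (p : κ → κ → ℤ)
    (e : κ → κ → ℕ) :
    (Matrix.of fun i j => C (p i j) * X ^ (e i j)).det =
      ∑ π : Equiv.Perm κ, C (((Equiv.Perm.sign π : ℤˣ) : ℤ) * ∏ j, p (π j) j) *
        X ^ (∑ j, e (π j) j) := by
  rw [Matrix.det_apply']
  refine Finset.sum_congr rfl fun π _ => ?_
  simp only [Matrix.of_apply]
  rw [Finset.prod_mul_distrib, Finset.prod_pow_eq_pow_sum, ← map_prod C, C_mul, ← mul_assoc]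
  congr 1

/-- Evaluating such a determinant: `G(ξ) = det (c_{ij} ξ^{e_{ij}})`. [folklore] -/
theorem aeval_det_monomialMatrix {κ : Type*} [Fintype κ] [DecidableEq κ] (p : κ → κ → ℤ)
    (e : κ → κ → ℕ) (ξ : ℂ) :
    aeval ξ (Matrix.of fun i j => C (p i j) * X ^ (e i j)).det =
      (Matrix.of fun i j => (p i j : ℂ) * ξ ^ (e i j)).det := by
  rw [AlgHom.map_det]
  congr 1
  ext i j
  simp

/-- The degree of a sum of monomials. [folklore] -/
theorem natDegree_sum_monomial_le {α : Type*} (s : Finset α) (c : α → ℤ) (e : α → ℕ) {N : ℕ}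
    (h : ∀ x ∈ s, e x ≤ N) : (∑ x ∈ s, C (c x) * X ^ (e x)).natDegree ≤ N :=
  natDegree_sum_le_of_forall_le _ _ fun x hx => (natDegree_C_mul_X_pow_le _ _).trans (h x hx)

/-- The length of a sum of monomials is at most the sum of the absolute values of the
coefficients. [folklore] -/
theorem length_sum_monomial_le {α : Type*} (s : Finset α) (c : α → ℤ) (e : α → ℕ) :
    ∑ k ∈ range ((∑ x ∈ s, C (c x) * X ^ (e x)).natDegree + 1),
        |((∑ x ∈ s, C (c x) * X ^ (e x)).coeff k : ℝ)| ≤ ∑ x ∈ s, |(c x : ℝ)| := by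
  classical
  set R := range ((∑ x ∈ s, C (c x) * X ^ (e x)).natDegree + 1) with hR
  calc ∑ k ∈ R, |((∑ x ∈ s, C (c x) * X ^ (e x)).coeff k : ℝ)|
      = ∑ k ∈ R, |∑ x ∈ s, (if k = e x then (c x : ℝ) else 0)| := by
        refine Finset.sum_congr rfl fun k _ => ?_
        simp only [finsetSum_coeff, coeff_C_mul_X_pow, Int.cast_sum, Int.cast_ite, Int.cast_zero]
    _ ≤ ∑ k ∈ R, ∑ x ∈ s, |(if k = e x then (c x : ℝ) else 0)| :=
        Finset.sum_le_sum fun k _ => Finset.abs_sum_le_sum_abs _ _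
    _ = ∑ x ∈ s, ∑ k ∈ R, |(if k = e x then (c x : ℝ) else 0)| := Finset.sum_comm
    _ ≤ ∑ x ∈ s, |(c x : ℝ)| := by
        refine Finset.sum_le_sum fun x _ => ?_
        have h : ∀ k, |(if k = e x then (c x : ℝ) else 0)| = if k = e x then |(c x : ℝ)| else 0 := by
          intro k; split_ifs <;> simp
        simp_rw [h]
        rw [Finset.sum_ite_eq']
        split_ifs
        · exact le_rfl
        · exact abs_nonneg _

/-! ### The functions `z^τ e^{tz}` -/

/-- `z ↦ z^τ e^{tz}` is entire. [folklore] -/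
theorem differentiable_monomialExp (τ : ℕ) (t : ℂ) :
    Differentiable ℂ (fun z : ℂ => z ^ τ * cexp (t * z)) :=
  (differentiable_id.pow τ).mul (differentiable_exp.comp (differentiable_id.const_mul t))

/-- **The derivatives of `z^τ e^{tz}`** ([NesterenkoWaldschmidt1996, (6.2)] with `Δ(z,τ,1) = z^τ`,
`θ = 1`): `(d/dz)^σ (z^τ e^{tz}) = ∑ₖ C(σ,k) τ(τ-1)⋯(τ-k+1) z^{τ-k} t^{σ-k} e^{tz}`.
[cite: NesterenkoWaldschmidt1996, §6 (6.2)] -/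
theorem iteratedDeriv_monomialExp (σ τ : ℕ) (t w : ℂ) :
    iteratedDeriv σ (fun z : ℂ => z ^ τ * cexp (t * z)) w =
      ∑ k ∈ range (σ + 1), (σ.choose k : ℂ) * ((τ.descFactorial k : ℂ) * w ^ (τ - k)) *
        (t ^ (σ - k) * cexp (t * w)) := by
  have hf : ContDiffAt ℂ (σ : ℕ∞) (fun z : ℂ => z ^ τ) w := (contDiff_id.pow τ).contDiffAt
  have hg : ContDiffAt ℂ (σ : ℕ∞) (fun z : ℂ => cexp (t * z)) w :=
    (Complex.contDiff_exp.comp (contDiff_const.mul contDiff_id)).contDiffAt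
  rw [iteratedDeriv_fun_mul hf hg]
  refine Finset.sum_congr rfl fun k _ => ?_
  rw [iteratedDeriv_pow, congrFun (iteratedDeriv_cexp_const_mul (σ - k) t) w]

/-- At an integer point: `(d/dz)^σ (z^τ e^{tz})|_{z=s} = pcoef σ τ s t · e^{ts}` (`e = exp 1`).
[cite: NesterenkoWaldschmidt1996, §6 (6.2)] -/
theorem iteratedDeriv_monomialExp_int (σ τ : ℕ) (s t : ℤ) :
    iteratedDeriv σ (fun z : ℂ => z ^ τ * cexp (t * z)) (s : ℂ) =
      (pcoef σ τ s t : ℂ) * cexp 1 ^ (t * s) := by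
  rw [iteratedDeriv_monomialExp, pcoef]
  have hexp : cexp ((t : ℂ) * (s : ℂ)) = cexp 1 ^ (t * s) := by
    rw [← Complex.exp_int_mul]; push_cast; ring_nf
  push_cast
  rw [Finset.sum_mul]
  refine Finset.sum_congr rfl fun k _ => ?_
  rw [hexp]
  ring

/-- **The bound on the discs** ([NesterenkoWaldschmidt1996, §6 b)]): for `σ ≤ S`, `τ ≤ T`,
`|t| ≤ T₁`, `1 ≤ R` and `|z| ≤ R`: `|(d/dz)^σ (z^τ e^{tz})| ≤ R^T (T+T₁)^S e^{T₁ R}`.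
[cite: NesterenkoWaldschmidt1996, §6 b)] -/
theorem norm_iteratedDeriv_monomialExp_le {σ τ S T T₁ : ℕ} {t : ℤ} (hσ : σ ≤ S) (hτ : τ ≤ T)
    (hT₁ : 1 ≤ T₁) (ht : |t| ≤ T₁) {R : ℝ} (hR : 1 ≤ R) {z : ℂ} (hz : ‖z‖ ≤ R) :
    ‖iteratedDeriv σ (fun z : ℂ => z ^ τ * cexp (t * z)) z‖ ≤
      R ^ T * ((T : ℝ) + T₁) ^ S * Real.exp (T₁ * R) := by
  have htr : |(t : ℝ)| ≤ T₁ := by rw [← Int.cast_abs]; exact_mod_cast ht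
  have htc : ‖(t : ℂ)‖ ≤ T₁ := by rw [Complex.norm_intCast]; exact htr
  have hR0 : 0 ≤ R := by linarith
  rw [iteratedDeriv_monomialExp]
  refine (norm_sum_le _ _).trans ?_
  have hexp : ‖cexp ((t : ℂ) * z)‖ ≤ Real.exp (T₁ * R) := by
    refine (Complex.norm_exp_le_exp_norm _).trans ?_
    rw [Real.exp_le_exp, norm_mul]
    exact mul_le_mul htc hz (norm_nonneg _) (by positivity)
  calc ∑ k ∈ range (σ + 1), ‖(σ.choose k : ℂ) * ((τ.descFactorial k : ℂ) * z ^ (τ - k)) *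
          ((t : ℂ) ^ (σ - k) * cexp ((t : ℂ) * z))‖
      ≤ ∑ k ∈ range (σ + 1), (T : ℝ) ^ k * (T₁ : ℝ) ^ (σ - k) * (σ.choose k : ℝ) *
          (R ^ T * Real.exp (T₁ * R)) := by
        refine Finset.sum_le_sum fun k _ => ?_
        rw [norm_mul, norm_mul, norm_mul, norm_mul, norm_pow, norm_pow, Complex.norm_natCast,
          Complex.norm_natCast]
        have h1 : (τ.descFactorial k : ℝ) ≤ (T : ℝ) ^ k := by
          calc (τ.descFactorial k : ℝ) ≤ (τ : ℝ) ^ k := by exact_mod_cast Nat.descFactorial_le_pow τ k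
            _ ≤ (T : ℝ) ^ k := pow_le_pow_left₀ (Nat.cast_nonneg _) (by exact_mod_cast hτ) k
        have h2 : ‖z‖ ^ (τ - k) ≤ R ^ T :=
          (pow_le_pow_left₀ (norm_nonneg _) hz _).trans
            (pow_le_pow_right₀ hR ((Nat.sub_le _ _).trans hτ))
        have h3 : ‖(t : ℂ)‖ ^ (σ - k) ≤ (T₁ : ℝ) ^ (σ - k) := pow_le_pow_left₀ (norm_nonneg _) htc _
        calc (σ.choose k : ℝ) * ((τ.descFactorial k : ℝ) * ‖z‖ ^ (τ - k)) *
              (‖(t : ℂ)‖ ^ (σ - k) * ‖cexp ((t : ℂ) * z)‖)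
            ≤ (σ.choose k : ℝ) * ((T : ℝ) ^ k * R ^ T) * ((T₁ : ℝ) ^ (σ - k) * Real.exp (T₁ * R)) := by
              gcongr
          _ = (T : ℝ) ^ k * (T₁ : ℝ) ^ (σ - k) * (σ.choose k : ℝ) * (R ^ T * Real.exp (T₁ * R)) := by
              ring
    _ = ((T : ℝ) + T₁) ^ σ * (R ^ T * Real.exp (T₁ * R)) := by rw [← Finset.sum_mul, add_pow]
    _ ≤ ((T : ℝ) + T₁) ^ S * (R ^ T * Real.exp (T₁ * R)) := by
        have hTT : (1 : ℝ) ≤ (T : ℝ) + T₁ := by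
          have : (1 : ℝ) ≤ T₁ := by exact_mod_cast hT₁
          linarith [(Nat.cast_nonneg T : (0 : ℝ) ≤ T)]
        gcongr
    _ = R ^ T * ((T : ℝ) + T₁) ^ S * Real.exp (T₁ * R) := by ring

/-! ### The perturbation `ξ^j - e^j` -/

/-- `|a^n - b^n| ≤ n 4^n |a - b|` for `|a|, |b| ≤ 4`. [folklore] -/
theorem norm_pow_sub_pow_le {a b : ℂ} (ha : ‖a‖ ≤ 4) (hb : ‖b‖ ≤ 4) (n : ℕ) :
    ‖a ^ n - b ^ n‖ ≤ n * 4 ^ n * ‖a - b‖ := by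
  induction n with
  | zero => simp
  | succ n ih =>
    have h : a ^ (n + 1) - b ^ (n + 1) = a * (a ^ n - b ^ n) + (a - b) * b ^ n := by ring
    rw [h]
    calc ‖a * (a ^ n - b ^ n) + (a - b) * b ^ n‖
        ≤ ‖a‖ * ‖a ^ n - b ^ n‖ + ‖a - b‖ * ‖b‖ ^ n := by
          refine (norm_add_le _ _).trans ?_
          rw [norm_mul, norm_mul, norm_pow]
      _ ≤ 4 * (n * 4 ^ n * ‖a - b‖) + ‖a - b‖ * 4 ^ n := by gcongr
      _ ≤ ((n + 1 : ℕ) : ℝ) * 4 ^ (n + 1) * ‖a - b‖ := by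
          push_cast
          rw [pow_succ]
          have h4 : (0 : ℝ) ≤ 4 ^ n * ‖a - b‖ := by positivity
          nlinarith [mul_nonneg (Nat.cast_nonneg n) h4]

/-- **The perturbation** ([NesterenkoWaldschmidt1996, §6 b)], `|β^k α^ℓ - θ^k e^{θℓ}|` for
`θ = β = 1`): if `1 ≤ |ξ| ≤ 4` then `|ξ^j - e^j| ≤ N 4^N |ξ - e|` for all integers `|j| ≤ N`.
[cite: NesterenkoWaldschmidt1996, §6 b)] -/
theorem norm_zpow_sub_zpow_le {ξ : ℂ} (hξ1 : 1 ≤ ‖ξ‖) (hξ4 : ‖ξ‖ ≤ 4) {N : ℕ} {j : ℤ}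
    (hj : |j| ≤ N) :
    ‖ξ ^ j - cexp 1 ^ j‖ ≤ N * 4 ^ N * ‖ξ - cexp 1‖ := by
  have he : ‖cexp 1‖ = Real.exp 1 := by
    rw [Complex.norm_exp]; simp
  have he1 : 1 ≤ ‖cexp 1‖ := by rw [he]; exact Real.one_le_exp zero_le_one
  have he4 : ‖cexp 1‖ ≤ 4 := by rw [he]; have := Real.exp_one_lt_d9; linarith
  have hξ0 : ξ ≠ 0 := fun h => by rw [h, norm_zero] at hξ1; exact absurd hξ1 (by norm_num)
  have he0 : cexp 1 ≠ 0 := Complex.exp_ne_zero 1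
  have hmono : ∀ n : ℕ, n ≤ N → (n : ℝ) * 4 ^ n * ‖ξ - cexp 1‖ ≤ N * 4 ^ N * ‖ξ - cexp 1‖ := by
    intro n hn
    have h1 : (n : ℝ) ≤ N := by exact_mod_cast hn
    have h2 : (4 : ℝ) ^ n ≤ 4 ^ N := pow_le_pow_right₀ (by norm_num) hn
    have h3 : 0 ≤ ‖ξ - cexp 1‖ := norm_nonneg _
    have : (n : ℝ) * 4 ^ n ≤ N * 4 ^ N := mul_le_mul h1 h2 (by positivity) (by positivity)
    exact mul_le_mul_of_nonneg_right this h3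
  rcases Int.eq_nat_or_neg j with ⟨n, rfl | rfl⟩
  · have hn : n ≤ N := by
      have : ((n : ℤ) : ℤ) ≤ N := le_trans (le_abs_self _) hj
      exact_mod_cast this
    rw [zpow_natCast, zpow_natCast]
    exact (norm_pow_sub_pow_le hξ4 he4 n).trans (hmono n hn)
  · have hn : n ≤ N := by
      have : |(-(n : ℤ))| ≤ N := hj
      rw [abs_neg] at this
      exact_mod_cast le_trans (le_abs_self _) this
    rw [_root_.zpow_neg, _root_.zpow_neg, zpow_natCast, zpow_natCast,
      inv_sub_inv (pow_ne_zero _ hξ0) (pow_ne_zero _ he0), norm_div, norm_mul, norm_pow, norm_pow]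
    have hden : 1 ≤ ‖ξ‖ ^ n * ‖cexp 1‖ ^ n :=
      one_le_mul_of_one_le_of_one_le (one_le_pow₀ hξ1) (one_le_pow₀ he1)
    calc ‖cexp 1 ^ n - ξ ^ n‖ / (‖ξ‖ ^ n * ‖cexp 1‖ ^ n) ≤ ‖cexp 1 ^ n - ξ ^ n‖ :=
          div_le_self (norm_nonneg _) hden
      _ = ‖ξ ^ n - cexp 1 ^ n‖ := norm_sub_rev _ _
      _ ≤ n * 4 ^ n * ‖ξ - cexp 1‖ := norm_pow_sub_pow_le hξ4 he4 n
      _ ≤ N * 4 ^ N * ‖ξ - cexp 1‖ := hmono n hn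

/-! ### Bookkeeping of the exponents -/

/-- `∑_{|t| ≤ T₁} |t| = T₁ (T₁ + 1)` (the total degree shift of the Laurent polynomial `det (a)`).
[folklore] -/
theorem sum_natAbs_sub_eq (T : ℕ) :
    ∑ b : Fin (2 * T + 1), (((b : ℕ) : ℤ) - T).natAbs = T * (T + 1) := by
  rw [Fin.sum_univ_eq_sum_range (fun k => ((k : ℤ) - T).natAbs) (2 * T + 1)]
  rw [← Finset.sum_range_add_sum_Ico _ (by omega : T ≤ 2 * T + 1)]
  have h1 : ∑ k ∈ Finset.range T, (((k : ℕ) : ℤ) - T).natAbs = ∑ k ∈ Finset.range T, (k + 1) := by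
    rw [← Finset.sum_range_reflect (fun k => k + 1) T]
    refine Finset.sum_congr rfl fun k hk => ?_
    have := Finset.mem_range.mp hk
    omega
  have h2 : ∑ k ∈ Finset.Ico T (2 * T + 1), (((k : ℕ) : ℤ) - T).natAbs =
      ∑ k ∈ Finset.range (T + 1), k := by
    rw [Finset.sum_Ico_eq_sum_range]
    have : 2 * T + 1 - T = T + 1 := by omega
    rw [this]
    refine Finset.sum_congr rfl fun k hk => ?_
    omega
  rw [h1, h2, Finset.sum_range_succ]
  have h4 : ∑ k ∈ Finset.range T, (k + 1) = (∑ k ∈ Finset.range T, k) + T := by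
    rw [Finset.sum_add_distrib]; simp
  rw [h4]
  have h3 := Finset.sum_range_id_mul_two T
  rcases Nat.eq_zero_or_pos T with rfl | hT
  · simp
  · obtain ⟨n, rfl⟩ : ∃ n, T = n + 1 := ⟨T - 1, by omega⟩
    have h5 : n + 1 - 1 = n := by omega
    rw [h5] at h3
    nlinarith

/-- `|s| ≤ S₁` for `s = d - S₁`, `0 ≤ d ≤ 2S₁`. [folklore] -/
theorem abs_coord_le (S₁ : ℕ) (d : Fin (2 * S₁ + 1)) : |((d : ℕ) : ℤ) - S₁| ≤ S₁ := by
  have := d.isLt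
  rw [abs_le]; omega

/-- The shifted exponent `ts + |t| S₁` is non-negative when `|s| ≤ S₁`. [folklore] -/
theorem shift_nonneg {t s : ℤ} {S₁ : ℕ} (hs : |s| ≤ S₁) : 0 ≤ t * s + |t| * S₁ := by
  have h1 : |t * s| ≤ |t| * S₁ := by rw [abs_mul]; exact mul_le_mul_of_nonneg_left hs (abs_nonneg _)
  have h2 := neg_abs_le (t * s)
  linarith

/-- … and at most `2 |t| S₁`. [folklore] -/
theorem shift_le {t s : ℤ} {S₁ : ℕ} (hs : |s| ≤ S₁) : t * s + |t| * S₁ ≤ 2 * (|t| * S₁) := by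
  have h1 : |t * s| ≤ |t| * S₁ := by rw [abs_mul]; exact mul_le_mul_of_nonneg_left hs (abs_nonneg _)
  have h2 := le_abs_self (t * s)
  linarith

end NW1996

end Literature.NumberTheory.Transcendental

end
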